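import Mathlib.RingTheory.Spectrum.Prime.FreeLocus
import Mathlib.RingTheory.LocalProperties.Exactness
import Mathlib.RingTheory.LocalRing.Module
import Mathlib.RingTheory.OrzechProperty
import Mathlib.RingTheory.FiniteType
import Mathlib.LinearAlgebra.Dimension.Free
import HarnessLib

/-!
# Equal-rank rigidity: a surjection between finite locally free modules of the same rank is an isomorphism

Topic `Literature/Algebra/Module`; namespace `Literature.Algebra.Module`.  THEOREMS ONLY (no definition, no named fact, no instance,
no notation, no `sorry`; Mathlib-only imports).  Cell `hodgecm-mathlib` (D-0151), FLOOR 0, P6 «MOD programme» generic organ (o-c2c)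
«EQUAL-RANK RIGIDITY» of the P6c desk's CENSUS-DICT v0 §4 (the engine of (b4′) «two finite flat closed subschemes of equal rank, one
inside the other, are EQUAL» and of DICT (c2) «reduction of kernels»); `--supports stmt-HodgeConjecture-24832`; COUNT-NEUTRAL: HC_CM is
proved only modulo the 7 printed citations until rung 0 closes; this file discharges none of them.

THE PRINT.  [Matsumura1987] Thm. 2.4 (Vasconcelos): a surjective endomorphism of a finite module over a commutative ring is injective
(Mathlib `OrzechProperty.injective_of_surjective_endomorphism`); a finite flat finitely presented module over a local ring is free
(Thm. 7.10; Mathlib `Module.free_of_flat_of_isLocalRing`); injectivity is local (Mathlib `injective_of_isLocalized_maximal`).  Hence: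

* `bijective_of_surjective_of_finrank_eq_of_isLocalRing` — over a LOCAL ring, a surjection between finite flat finitely presented
  modules of the same `Module.finrank` is bijective;
* **`bijective_of_surjective_of_rankAtStalk_eq`** — over ANY commutative ring, a surjection between finite flat finitely presented
  modules (= finite locally free) with the same rank function `Module.rankAtStalk` is bijective;
* **`ideal_eq_of_le_of_rankAtStalk_eq`** — IDEAL form: `I ≤ J` in an `R`-algebra `B` with `B ⧸ I`, `B ⧸ J` finite locally free over `R`
  of the same rank function ⇒ `I = J` (no domain ∕ reducedness hypothesis on `R`).

NOT HERE: the scheme form (a closed immersion of finite locally free `S`-schemes of equal rank is an isomorphism — sibling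
`Morphisms/ClosedImmersionOfEqualFinrankIsIso.lean`).

## References
* [Matsumura1987] H. Matsumura, *Commutative Ring Theory* (1986/87) — Thm. 2.4 (p. 9), Thm. 7.10 (p. 51).
-/

namespace Literature.Algebra.Module

variable {R : Type*} [CommRing R] {M N : Type*} [AddCommGroup M] [Module R M] [AddCommGroup N] [Module R N]

/-- **Local case**: over a LOCAL ring, a surjective linear map between finite flat finitely presented modules (hence free) of the
same rank is bijective (both are free of the same rank; a surjective endomorphism of a finite module is injective, Vasconcelos ∕
Orzech). [cite: Matsumura1987, Thm. 2.4 (p. 9) and Thm. 7.10 (p. 51)] -/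
theorem bijective_of_surjective_of_finrank_eq_of_isLocalRing [IsLocalRing R] [_root_.Module.FinitePresentation R M] [_root_.Module.Flat R M]
    [_root_.Module.FinitePresentation R N] [_root_.Module.Flat R N] (f : M →ₗ[R] N) (hf : Function.Surjective f)
    (h : Module.finrank R M = Module.finrank R N) : Function.Bijective f := by
  haveI : _root_.Module.Free R M := _root_.Module.free_of_flat_of_isLocalRing
  haveI : _root_.Module.Free R N := _root_.Module.free_of_flat_of_isLocalRing
  let e : N ≃ₗ[R] M := LinearEquiv.ofFinrankEq N M h.symm
  have hs : Function.Surjective (e.toLinearMap ∘ₗ f) := e.surjective.comp hf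
  have hi : Function.Injective (e.toLinearMap ∘ₗ f) := OrzechProperty.injective_of_surjective_endomorphism _ hs
  exact ⟨fun x y hxy => hi (by simp [hxy]), hf⟩

/-- **EQUAL-RANK RIGIDITY**: a SURJECTIVE linear map between finite, flat, finitely presented `R`-modules (= finite locally free)
with the same rank function `Module.rankAtStalk` is BIJECTIVE (injectivity is checked after localising at every maximal ideal,
where §`bijective_of_surjective_of_finrank_eq_of_isLocalRing` applies). [cite: Matsumura1987, Thm. 2.4 (p. 9)] -/
theorem bijective_of_surjective_of_rankAtStalk_eq [_root_.Module.FinitePresentation R M] [_root_.Module.Flat R M]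
    [_root_.Module.FinitePresentation R N] [_root_.Module.Flat R N] (f : M →ₗ[R] N) (hf : Function.Surjective f)
    (h : ∀ P : PrimeSpectrum R, _root_.Module.rankAtStalk M P = _root_.Module.rankAtStalk N P) : Function.Bijective f := by
  refine ⟨?_, hf⟩
  refine injective_of_isLocalized_maximal (fun P _ => LocalizedModule P.primeCompl M)
    (fun P _ => LocalizedModule.mkLinearMap P.primeCompl M) (fun P _ => LocalizedModule P.primeCompl N)
    (fun P _ => LocalizedModule.mkLinearMap P.primeCompl N) f fun P hP => ?_
  rw [IsLocalizedModule.map_injective_iff_localizedModuleMap_injective]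
  have hs : Function.Surjective (LocalizedModule.map P.primeCompl f) :=
    (IsLocalizedModule.map_surjective_iff_localizedModuleMap_surjective
      (LocalizedModule.mkLinearMap P.primeCompl M) (LocalizedModule.mkLinearMap P.primeCompl N)).mp
      (IsLocalizedModule.map_surjective _ _ _ f hf)
  exact (bijective_of_surjective_of_finrank_eq_of_isLocalRing (R := Localization.AtPrime P)
    (LocalizedModule.map P.primeCompl f) hs (h ⟨P, hP.isPrime⟩)).1

/-- **IDEAL FORM** («two finite locally free closed subschemes of the same rank, one inside the other, coincide»): for ideals
`I ≤ J` of an `R`-algebra `B` with `B ⧸ I` and `B ⧸ J` finite, flat and finitely presented over `R` of the same rank function,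
`I = J`. [cite: Matsumura1987, Thm. 2.4 (p. 9)] -/
theorem ideal_eq_of_le_of_rankAtStalk_eq {B : Type*} [CommRing B] [Algebra R B] {I J : Ideal B} (hIJ : I ≤ J)
    [_root_.Module.FinitePresentation R (B ⧸ I)] [_root_.Module.Flat R (B ⧸ I)] [_root_.Module.FinitePresentation R (B ⧸ J)] [_root_.Module.Flat R (B ⧸ J)]
    (h : ∀ P : PrimeSpectrum R, _root_.Module.rankAtStalk (B ⧸ I) P = _root_.Module.rankAtStalk (B ⧸ J) P) : I = J := by
  let q : (B ⧸ I) →ₐ[R] (B ⧸ J) := Ideal.Quotient.factorₐ R hIJ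
  have hq : Function.Surjective q := Ideal.Quotient.factor_surjective hIJ
  have hinj := (bijective_of_surjective_of_rankAtStalk_eq q.toLinearMap hq h).1
  refine le_antisymm hIJ fun x hx => ?_
  have hx0 : q (Ideal.Quotient.mk I x) = 0 := by
    change Ideal.Quotient.factor hIJ (Ideal.Quotient.mk I x) = 0
    rw [Ideal.Quotient.factor_mk, Ideal.Quotient.eq_zero_iff_mem]
    exact hx
  have : Ideal.Quotient.mk I x = 0 := hinj (by change q (Ideal.Quotient.mk I x) = q 0; rw [hx0, map_zero])
  exact Ideal.Quotient.eq_zero_iff_mem.mp this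

end Literature.Algebra.Module
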